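import Literature.AnabelianGeometry.EtaleTheta.DoubleUnderline
import Literature.AnabelianGeometry.SemiGraphs.TemperedArithmeticGroupOfOpenSubgroup
import Literature.AnabelianGeometry.SemiGraphs.TemperedOpenMapping

/-!
# [EtTh] §5 at the §1 Setting: the group-side inputs `haug`, `hYdd`, `hker` of the origin clauses are THEOREMS for `Π^tp_X̲̲ = C.Huu`
# (Prop. 2.2 (iii) p.263, Def. 2.13 p.273, §5 p.322 / PDF pp.37, 47, 96)

Mochizuki, *The étale theta function and its Frobenioid-theoretic manifestations*, Publ. RIMS **45** (2009)
[cite: MochizukiEtTh2009, Prop 2.2 (iii) p.263 (PDF p.37); §5 p.322 (PDF p.96)]; Mochizuki, *Semi-graphs of anabelioids*, Publ. RIMS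
**42** (2006), Ex. 3.10 p.43 [cite: MochizukiSemiAnbd2006, Ex 3.10 p.43].  abc-iut cell, layer L2 (seat abc-iut-w4-d008, gen 4; row «haug +
hYdd PRODUCERS at the junction», abc-iut-L2-lead GO 2026-08-26T09:39:43Z).  PROOF-ONLY (0 definitions) over abc-iut-L2-t2/t8's
`ThetaSetting.EtaleThetaData.DoubleUnderline` (`DoubleUnderline.lean`; t8's `thetaEnvData` of `ThetaEnvOfSetting.lean` is only referred to),
abc-iut-L2-t4's `TemperedCurve.temperedArithmeticGroupOfOpenSubgroup` (p433008) and abc-iut-L3's open mapping theorem for tempered groups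
(`TemperedOpenMapping.lean`).

WHAT.  abc-iut-L2-t4's junction `ThetaFrobenioid.ofThetaSettingData` (`Discharge/Sec5OfThetaSetting.lean`) reads the §5 data on
`X := C.temperedArithmeticGroup e := D.toTemperedCurve.temperedArithmeticGroupOfOpenSubgroup e C.Huu C.isOpen_Huu C.map_aug_Huu` (the
[SemiAnbd] Ex. 3.10 datum of `Π^tp_X̲̲ = C.Huu`), `T := C.thetaEnvData μ hC hS` (`PiX = C.Huu`, `PiYdd = Π^tp_Ÿ̲̲ = D.GtpYdd.subgroupOf C.Huu`,
`aug` = the co-restriction of `D.aug` to `G_K`), `ιX := id`.  This seat's origin-clause files (`Discharge/Sec5OriginClausesOfPushforward`,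
p433787; `Discharge/Sec5HfacOfPushforward`, p436167) take three group-side inputs there; all three are THEOREMS at this datum:
* **`haug`** — `IsOpenMap X.aug`: by abc-iut-L3's `TemperedArithmeticGroup.augIsOpenMap_holds` (EVERY `TemperedArithmeticGroup` has open
  augmentation: open mapping theorem for tempered groups), recorded at the datum as `isOpenMap_aug_ofHuu`;
* **`hYdd`** — `∀ y, ∃ k ∈ Π^tp_Ÿ̲̲, aug k = aug y`: from the FIELD `E.DoubleUnderline.map_aug_Ydduu : aug(Π^tp_Ÿ ∩ Π^tp_X̲̲) = G_K` («`Ÿ̲̲` is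
  geometrically connected over `K = K̈`», Prop. 2.2 (iii) p.263 / §5 p.322), `exists_mem_GtpYdd_aug_eq` (stated on `D.aug`) and
  **`hYdd_ofHuu`** (stated on `X.aug`, the VERBATIM `hYdd` shape at `ιX := id`);
* **`hker`** — `∀ δ ∈ T.aug.ker, X.aug δ = 1`: bookkeeping between t8's co-restricted augmentation and `augK = galEquiv ∘ augGK`,
  **`aug_ofHuu_eq_one_of_aug_eq_one`** (in `D.aug`-currency; `δ ∈ T.aug.ker` unfolds to it by `Subtype.ext`).
Hence at the junction: the binder `hfac` of GAP G-L2d4-1 ⟸ {`Prop34Cnst`, `e`} and abc-iut-w5-d020's T56-L09b `hconst` ⟸ {`Prop34Cnst`, `e`},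
where `e : tf.base ⋙ cnst ≅ aug_* ⋙ G` is print's DEFINITION of `D₀ → D^cnst` ([EtTh] §3 p.298 / [FrdII] Ex. 1.3 (ii)) and `Prop34Cnst` is
abc-iut-L2-t3's Prop. 3.4 (ii) hypothesis structure.  HONEST FRAMING: group-theoretic bookkeeping over the typed §1/§2 Setting; nothing of
[EtTh] §5 is asserted; typed ≠ proved; no side taken on [IUTchIII] Cor. 3.12.
-/

noncomputable section

namespace Literature.AnabelianGeometry.EtaleTheta

open Literature.AnabelianGeometry.SemiGraphs

namespace ThetaSetting.EtaleThetaData.DoubleUnderline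

variable {p : ℕ} [Fact p.Prime] {D : ThetaSetting p} {E : D.EtaleThetaData} {l : ℕ} (C : E.DoubleUnderline l)

/-- **`Ÿ̲̲` geometrically connected over `K = K̈`, pointwise**: every element of `Π^tp_X̲̲` has the same image in `G_K` as some element of
`Π^tp_Ÿ̲̲ = Π^tp_Ÿ ∩ Π^tp_X̲̲` (the field `map_aug_Ydduu` of the `DoubleUnderline` datum, Prop. 2.2 (iii) p.263; §5 p.322 «`K = K̈`»).
[cite: MochizukiEtTh2009, Prop 2.2 (iii) p.263 (PDF p.37)] -/
theorem exists_mem_GtpYdd_aug_eq (y : C.Huu) :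
    ∃ k : C.Huu, k ∈ D.GtpYdd.subgroupOf C.Huu ∧ D.aug.toMonoidHom (k : D.PiTemp) = D.aug.toMonoidHom (y : D.PiTemp) := by
  have hy : D.aug.toMonoidHom (y : D.PiTemp) ∈ (D.GtpYdd ⊓ C.Huu).map D.aug.toMonoidHom := by
    rw [C.map_aug_Ydduu]
    exact D.aug_mem_GK (y : D.PiTemp)
  obtain ⟨k, ⟨hkY, hkH⟩, hk⟩ := hy
  exact ⟨⟨k, hkH⟩, Subgroup.mem_subgroupOf.mpr hkY, hk⟩

variable (e : D.toTemperedCurve.GroupLevelData)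

/-- **`haug` at the junction datum is a theorem**: the augmentation of the [SemiAnbd] Ex. 3.10 datum of `Π^tp_X̲̲ = C.Huu`
(abc-iut-L2-t4's `C.temperedArithmeticGroup e`, unfolded) is an OPEN map — an instance of abc-iut-L3's open mapping theorem for tempered
groups `TemperedArithmeticGroup.augIsOpenMap_holds`.  [cite: MochizukiSemiAnbd2006, Ex 3.10 p.43] -/
theorem isOpenMap_aug_ofHuu :
    IsOpenMap (D.toTemperedCurve.temperedArithmeticGroupOfOpenSubgroup e C.Huu C.isOpen_Huu C.map_aug_Huu).aug :=
  (D.toTemperedCurve.temperedArithmeticGroupOfOpenSubgroup e C.Huu C.isOpen_Huu C.map_aug_Huu).augIsOpenMap_holds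

/-- Elements of `Π^tp_X̲̲` with the same image under `D.aug` have the same image under the augmentation `augK = galEquiv ∘ augGK` of the
Ex. 3.10 datum.  [cite: MochizukiSemiAnbd2006, Ex 3.10 p.43] -/
theorem aug_ofHuu_eq_of_aug_eq {k y : C.Huu} (h : D.aug.toMonoidHom (k : D.PiTemp) = D.aug.toMonoidHom (y : D.PiTemp)) :
    (D.toTemperedCurve.temperedArithmeticGroupOfOpenSubgroup e C.Huu C.isOpen_Huu C.map_aug_Huu).aug k =
      (D.toTemperedCurve.temperedArithmeticGroupOfOpenSubgroup e C.Huu C.isOpen_Huu C.map_aug_Huu).aug y := by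
  rw [TemperedCurve.temperedArithmeticGroupOfOpenSubgroup_aug_apply, TemperedCurve.temperedArithmeticGroupOfOpenSubgroup_aug_apply]
  have hGK : D.toTemperedCurve.augGK (k : D.PiTemp) = D.toTemperedCurve.augGK (y : D.PiTemp) := Subtype.ext h
  change e.galEquiv (D.toTemperedCurve.augGK (k : D.PiTemp)) = e.galEquiv (D.toTemperedCurve.augGK (y : D.PiTemp))
  rw [hGK]

/-- **`hYdd` at the junction datum** (VERBATIM shape of the binder of `hcnst_ofConnectedTemperoidData_of_pushforward` /
`hfac_ofConnectedTemperoidData_of_pushforward` at `T := C.thetaEnvData μ hC hS`, `ιX := id`): every `y ∈ Π^tp_X̲̲` has the same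
augmentation as some `k ∈ Π^tp_Ÿ̲̲ = D.GtpYdd.subgroupOf C.Huu`.  [cite: MochizukiEtTh2009, Prop 2.2 (iii) p.263 (PDF p.37); §5 p.322 (PDF p.96)] -/
theorem hYdd_ofHuu :
    ∀ y : C.Huu, ∃ k ∈ D.GtpYdd.subgroupOf C.Huu,
      (D.toTemperedCurve.temperedArithmeticGroupOfOpenSubgroup e C.Huu C.isOpen_Huu C.map_aug_Huu).aug k =
        (D.toTemperedCurve.temperedArithmeticGroupOfOpenSubgroup e C.Huu C.isOpen_Huu C.map_aug_Huu).aug y := by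
  intro y
  obtain ⟨k, hk, hky⟩ := C.exists_mem_GtpYdd_aug_eq y
  exact ⟨k, hk, C.aug_ofHuu_eq_of_aug_eq e hky⟩

/-- **`hker` at the junction datum, in `D.aug`-currency**: an element of `Π^tp_X̲̲` killed by the Setting's augmentation `D.aug` is killed by
the augmentation of the Ex. 3.10 datum.  (abc-iut-L2-t8's §2 datum `C.thetaEnvData μ hC hS` has `aug :=` the co-restriction of `D.aug` to
`G_K` on `C.Huu`, so `δ ∈ T.aug.ker` unfolds to this hypothesis by `Subtype.ext`; that three-line conversion is left to the junction so that
this file carries no `D.Compat` binder.)  [cite: MochizukiEtTh2009, Def 2.13 p.273 (PDF p.47)] -/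
theorem aug_ofHuu_eq_one_of_aug_eq_one {δ : C.Huu} (h : D.aug.toMonoidHom (δ : D.PiTemp) = 1) :
    (D.toTemperedCurve.temperedArithmeticGroupOfOpenSubgroup e C.Huu C.isOpen_Huu C.map_aug_Huu).aug δ = 1 := by
  have h1 : D.aug.toMonoidHom (δ : D.PiTemp) = D.aug.toMonoidHom ((1 : C.Huu) : D.PiTemp) := by
    rw [h, Subgroup.coe_one, map_one]
  exact (C.aug_ofHuu_eq_of_aug_eq e h1).trans
    (map_one (D.toTemperedCurve.temperedArithmeticGroupOfOpenSubgroup e C.Huu C.isOpen_Huu C.map_aug_Huu).aug)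

end ThetaSetting.EtaleThetaData.DoubleUnderline

end Literature.AnabelianGeometry.EtaleTheta

end
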